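import Literature.NumberTheory.Rogawski1990.RankOneUnstableDeltaValueInert
import Literature.NumberTheory.Rogawski1990.FinExplicitTransferFactorNondegenerate
import HarnessLib

/-!
# The VALUE of `τ_v(γ_H) · D_{G∕H,v}(γ_H)` for a DEEP `γ_H ∈ H_v` with split `U(Φ₂)`-part at an unramified inert place: `(−q)^{−(n₀+n₁)}` up to a constant
# ([Rogawski1990] §4.9 p. 55, Prop. 8.1.3 p. 116; [LabesseLanglands1979] §2)

Topic `NumberTheory/Rogawski1990`; namespace `Literature.NumberTheory.Rogawski1990`.  THEOREMS ONLY (no definition, no instance, no notation, no named fact, no `sorry`).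
Cell `pub/hodgecm-mathlib` (D-0151), crux H413 = `stmt-HodgeConjecture-24833`, line «N6nsGerm», last open stub `stub_N6nsS3id` (local `Δ‴_v`-transfer AT THE IDENTITY, PRINT);
architect A-p16 (g28) census «S3» v2 8d373588 §4 road (R-T), brick **T5 «the `Δ‴_v` bookkeeping near `1`»**; CENSUS-T5 `F0/P3a/F0P3a-p04/g15/CENSUS-T5-DeltaNearIdentity…`
(F0P3a-p04 (g15)), items T5-a∕T5-b.  ROAD-INDEPENDENT: a statement about the ★ explicit factor `Δ‴_v = τ_v · D_{G∕H,v} · κ_v` (typ-T6b ★ `FinExplicitTransferFactor`) alone.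
HONEST LABEL: HC_CM is proved only modulo the printed citations (2 remaining named inputs hLiu418, h413) until rung 0 closes; nothing printed is asserted here.

THE MATHEMATICS (one non-split `v` of `L⁺` UNRAMIFIED in `L`, `w ∣ v`, `E_v = L_w`, `q = #k_v`; `μ` with print's guard `μ|_{𝕀_{L⁺}} = ω_{L∕L⁺}`).  For `γ_H = (g, u) ∈ H_v`
whose `U(Φ₂)`-part has NORM-ONE eigenvalues `d₀, d₁ ∈ E_v` (type (1) torus; supplied by the caller's frame as the two identities `χ_g(u) = (u − d₀)(u − d₁)`,
`det g⁻¹ · d₀d₁ = 1`) and DEPTHS `|u − d_i|_w = |ϖ_v|_w^{n_i}`, `n_i ≥ M₀(μ)`: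
  `τ_v(γ_H) · D_{G∕H,v}(γ_H) = μ_v(u) · C · (−1)^{n₀+n₁} · q^{−(n₀+n₁)}`,  `C ≠ 0` a constant of `(L, v, w, μ)`
(`τ_v = μ_v(u)·μ_v(−χ_g(u)∕det g)⁻¹` ★ `finTau`, `D_{G∕H,v} = (Π_{w′}‖χ_g(u)_{w′}‖)^{1∕2}` ★ `finWeylRatio`).  PROOF: `−χ_g(u)∕det g = (−1)·(u − d₀)·(u − d₁)·det g⁻¹`, `μ_v`
is multiplicative on units (★ `finHeckeValue_mul`), `μ_v(det g⁻¹) = μ_v(d₀d₁)⁻¹`, the norm is multiplicative; so `τ·D = μ_v(u)·μ_v(−1)⁻¹·μ_v(d₀)μ_v(d₁) ·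
Π_i [μ_v(u − d_i)⁻¹ (Π‖(u − d_i)‖)^{1∕2}]`, and EACH bracket is ★ I-4b's rank-one value `μ_v(d_i)⁻¹ · C₁⁻¹ · (−1)^{n_i} q^{−n_i}`
(★ `exists_finHeckeValue_sub_inv_mul_sqrt_eq`, p843099) — i.e. the rank-3 factor `Δ_{G∕H} = τ·D` near the identity is the PRODUCT of the two rank-one factors
`Δ_{H∕C}` of Lemma 4.9.3 for the pairs `(u, d₀)`, `(u, d₁)`; `C = μ_v(−1)⁻¹ C₁⁻²`.  (When `μ_v(u) = 1`, e.g. `u` deep, this is `(−q)^{−(n₀+n₁)}` up to `C`.)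

* §1 bookkeeping: `finHeckeValue_one'` (`μ_v(1) = 1`), `finHeckeValue_ne_zero_of_isUnit`, `isUnit_of_valued_sub_eq` (depth hypothesis ⇒ `u − d` is a unit),
  `sqrt_prod_norm_mul` (`(Π‖xy‖)^{1∕2} = (Π‖x‖)^{1∕2}(Π‖y‖)^{1∕2}`).
* §2 HEAD **`exists_finTau_mul_finWeylRatio_eq_of_depths`**.

## References
* [Rogawski1990] J. D. Rogawski, *Automorphic Representations of Unitary Groups in Three Variables*, Ann. of Math. Stud. 123 (1990): §4.9 p. 55 (`τ`, `D_{G∕H}`), Lemma 4.9.3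
  p. 56, Prop. 8.1.3 and its proof p. 116 («for `t` sufficiently close to `1`»).
* [LabesseLanglands1979] J.-P. Labesse, R. P. Langlands, *L-indistinguishability for SL(2)*, Canad. J. Math. 31 (1979): §2.
-/

set_option autoImplicit false

noncomputable section

open NumberField IsDedekindDomain Filter Topology

namespace Literature.NumberTheory.Rogawski1990

open Literature.NumberTheory.Automorphic Literature.NumberTheory.Automorphic.UnitaryGroup Literature.NumberTheory.GaloisRepresentations

variable (L : Type) [Field L] [NumberField L] [IsCMField L] (v : HeightOneSpectrum (𝓞 ↥(maximalRealSubfield L)))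
  (w : PlacesOver L v) (hw : IsCMField.complexConj L • w.1 = w.1)

/-! ## §1 Bookkeeping -/

section Bookkeeping

omit [IsCMField L] in
/-- `μ_v(1) = 1`. [cite: Rogawski1990, §4.9 p. 55] -/
theorem finHeckeValue_one' (μ : HeckeCharacter L) : finHeckeValue L v μ 1 = 1 := by
  have h := finHeckeValue_mul L v μ (x := 1) (y := 1) isUnit_one isUnit_one
  rw [one_mul] at h
  have h0 := finHeckeValue_ne_zero_of_isUnit L v μ (x := 1) isUnit_one
  calc finHeckeValue L v μ 1 = finHeckeValue L v μ 1 * finHeckeValue L v μ 1 * (finHeckeValue L v μ 1)⁻¹ := by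
        rw [mul_inv_cancel_right₀ h0]
    _ = finHeckeValue L v μ 1 * (finHeckeValue L v μ 1)⁻¹ := by rw [← h]
    _ = 1 := mul_inv_cancel₀ h0

omit [IsCMField L] in
/-- `μ_v(x)·μ_v(y) = 1` when `x·y = 1` (units). [cite: Rogawski1990, §4.9 p. 55] -/
theorem finHeckeValue_mul_eq_one_of_mul_eq_one (μ : HeckeCharacter L) {x y : LocalRing L v} (hxy : x * y = 1) :
    finHeckeValue L v μ x * finHeckeValue L v μ y = 1 := by
  have hx : IsUnit x := IsUnit.of_mul_eq_one y hxy
  have hy : IsUnit y := IsUnit.of_mul_eq_one_right x hxy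
  rw [← finHeckeValue_mul L v μ hx hy, hxy, finHeckeValue_one']

include hw in
/-- The depth hypothesis `|x_w − y_w|_w = |ϖ^n|_w` makes `x − y` a unit of `E_v = L_w` (non-split `v`). [cite: Rogawski1990, §4.9 p. 55] -/
theorem isUnit_sub_of_valued_sub_eq {x y : LocalRing L v} {n : ℕ}
    (h : Valued.v (x w - y w) =
      Valued.v ((toPlace v w (HeckeCharacter.uniformizer ↥(maximalRealSubfield L) v : v.adicCompletion ↥(maximalRealSubfield L))) ^ n)) :
    IsUnit (x - y) := by
  haveI : Algebra.IsQuadraticExtension ↥(maximalRealSubfield L) L := IsCMField.isQuadraticExtension L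
  haveI hv : Subsingleton (PlacesOver L v) :=
    PlacesOver.subsingleton_of_smul_eq (IsCMField.complexConj L) (IsCMField.complexConj_ne_one L) w hw
  have hϖ0 : (toPlace v w (HeckeCharacter.uniformizer ↥(maximalRealSubfield L) v : v.adicCompletion ↥(maximalRealSubfield L))) ≠ 0 := by
    rw [map_ne_zero]
    exact_mod_cast (HeckeCharacter.uniformizer ↥(maximalRealSubfield L) v).ne_zero
  have hz : x w - y w ≠ 0 := fun h0 => by
    rw [h0, map_zero] at h
    exact (Valuation.ne_zero_iff _).2 (pow_ne_zero n hϖ0) h.symm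
  refine isUnit_localRing_of_ne_zero_of_subsingleton L v hv fun h0 => hz ?_
  rw [← Pi.sub_apply, h0, Pi.zero_apply]

/-- A norm-one element of `E_v` is a unit. [cite: Rogawski1990, §4.9 p. 55] -/
theorem isUnit_of_conjLocal_mul_self {x : LocalRing L v} (hx : conjLocal L (IsCMField.complexConj L) v x * x = 1) : IsUnit x :=
  IsUnit.of_mul_eq_one_right _ hx

omit [IsCMField L] in
/-- `(Π_{w′}‖(xy)_{w′}‖)^{1∕2} = (Π‖x‖)^{1∕2}·(Π‖y‖)^{1∕2}`. [cite: NeukirchANT1999, Ch. II §6] -/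
theorem sqrt_prod_norm_mul (x y : LocalRing L v) :
    Real.sqrt (∏ w' : PlacesOver L v, ‖(x * y) w'‖) = Real.sqrt (∏ w' : PlacesOver L v, ‖x w'‖) * Real.sqrt (∏ w' : PlacesOver L v, ‖y w'‖) := by
  rw [← Real.sqrt_mul (Finset.prod_nonneg fun _ _ => norm_nonneg _), ← Finset.prod_mul_distrib]
  congr 1
  exact Finset.prod_congr rfl fun w' _ => by rw [Pi.mul_apply, norm_mul]

end Bookkeeping

/-! ## §2 HEAD — `τ_v · D_{G∕H,v}` on the deep type-(1) locus -/

section Head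

variable (hunr : Algebra.IsUnramifiedIn (𝓞 L) v.asIdeal) (μ : HeckeCharacter L)
  (hμω : ∀ x : ideleGroup ↥(maximalRealSubfield L), μ (AdeleRing.ideleBaseChange ↥(maximalRealSubfield L) L x) = quadraticHeckeCharCM L x)

include hw hunr hμω in
/-- **HEAD (T5-a∕b).**  At a non-split place `v` UNRAMIFIED in the CM field `L` (`w ∣ v`), for `μ` with print's guard `μ|_{𝕀_{L⁺}} = ω_{L∕L⁺}`: there are a level `M₀` and a
constant `C ≠ 0` such that for every `γ_H = (g, u) ∈ H_v` and norm-one `d₀, d₁ ∈ E_v` with `χ_g(u) = (u − d₀)(u − d₁)`, `det g⁻¹·(d₀d₁) = 1` (the eigenvalues of `g`,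
from the caller's frame) and depths `|u_w − (d_i)_w|_w = |ϖ_v|_w^{n_i}`, `n_i ≥ M₀`:
`τ_v(γ_H) · D_{G∕H,v}(γ_H) = μ_v(u) · C · (−1)^{n₀+n₁} · q^{−(n₀+n₁)}` (`q = #k_v`) — the rank-3 factor is the product of the two rank-one values of ★ I-4b.
[cite: Rogawski1990, §4.9 p. 55; Lemma 4.9.3 p. 56; Prop. 8.1.3 p. 116] [cite: LabesseLanglands1979, §2] -/
theorem exists_finTau_mul_finWeylRatio_eq_of_depths :
    ∃ (M₀ : ℕ) (C : ℂ), C ≠ 0 ∧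
      ∀ (γH : (cmDatum L 2 (Matrix.of fun i j : Fin 2 => if i.val + j.val + 1 = 2 then (1 : L) else 0)).Local v ×
          (cmDatum L 1 (Matrix.of fun i j : Fin 1 => if i.val + j.val + 1 = 1 then (1 : L) else 0)).Local v)
        (d₀ d₁ : LocalRing L v) (n₀ n₁ : ℕ), M₀ ≤ n₀ → M₀ ≤ n₁ →
        conjLocal L (IsCMField.complexConj L) v d₀ * d₀ = 1 → conjLocal L (IsCMField.complexConj L) v d₁ * d₁ = 1 →
        conjLocal L (IsCMField.complexConj L) v (finGammaTwo L v γH) * finGammaTwo L v γH = 1 →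
        (finCharpolyTwo L v γH).eval (finGammaTwo L v γH) = (finGammaTwo L v γH - d₀) * (finGammaTwo L v γH - d₁) →
        ((γH.1.val⁻¹).val : Matrix (Fin 2) (Fin 2) (LocalRing L v)).det * (d₀ * d₁) = 1 →
        Valued.v (finGammaTwo L v γH w - d₀ w) =
          Valued.v ((toPlace v w (HeckeCharacter.uniformizer ↥(maximalRealSubfield L) v : v.adicCompletion ↥(maximalRealSubfield L))) ^ n₀) →
        Valued.v (finGammaTwo L v γH w - d₁ w) =
          Valued.v ((toPlace v w (HeckeCharacter.uniformizer ↥(maximalRealSubfield L) v : v.adicCompletion ↥(maximalRealSubfield L))) ^ n₁) →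
        finTau L v γH μ * (finWeylRatio L v γH : ℂ) =
          finHeckeValue L v μ (finGammaTwo L v γH) * C *
            ((-1 : ℂ) ^ (n₀ + n₁) * (((Nat.card (𝓞 ↥(maximalRealSubfield L) ⧸ v.asIdeal) : ℂ) ^ (n₀ + n₁)))⁻¹) := by
  obtain ⟨M₀, C₁, hC₁, hcore⟩ := exists_finHeckeValue_sub_inv_mul_sqrt_eq L v w hw hunr μ hμω
  have hm1 : IsUnit (-1 : LocalRing L v) := isUnit_one.neg
  have hμm1 : finHeckeValue L v μ (-1) ≠ 0 := finHeckeValue_ne_zero_of_isUnit L v μ hm1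
  refine ⟨M₀, (finHeckeValue L v μ (-1))⁻¹ * (C₁⁻¹ * C₁⁻¹), mul_ne_zero (inv_ne_zero hμm1) (mul_ne_zero (inv_ne_zero hC₁) (inv_ne_zero hC₁)),
    fun γH d₀ d₁ n₀ n₁ hn₀ hn₁ hd₀ hd₁ hu hχ hdet hv₀ hv₁ => ?_⟩
  set u := finGammaTwo L v γH with hudef
  set q : ℂ := (Nat.card (𝓞 ↥(maximalRealSubfield L) ⧸ v.asIdeal) : ℂ) with hqdef
  -- units everywhere
  have hud₀ : IsUnit (u - d₀) := isUnit_sub_of_valued_sub_eq L v w hw hv₀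
  have hud₁ : IsUnit (u - d₁) := isUnit_sub_of_valued_sub_eq L v w hw hv₁
  have hdu₀ : IsUnit d₀ := isUnit_of_conjLocal_mul_self L v hd₀
  have hdu₁ : IsUnit d₁ := isUnit_of_conjLocal_mul_self L v hd₁
  have huu : IsUnit u := isUnit_of_conjLocal_mul_self L v hu
  have hdetu : IsUnit (((γH.1.val⁻¹).val : Matrix (Fin 2) (Fin 2) (LocalRing L v)).det) := IsUnit.of_mul_eq_one _ hdet
  -- the two rank-one values
  have h₀ := hcore u d₀ n₀ hn₀ hu hd₀ hv₀
  have h₁ := hcore u d₁ n₁ hn₁ hu hd₁ hv₁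
  -- non-vanishing of the `μ`-values
  have hμud₀ : finHeckeValue L v μ (u - d₀) ≠ 0 := finHeckeValue_ne_zero_of_isUnit L v μ hud₀
  have hμud₁ : finHeckeValue L v μ (u - d₁) ≠ 0 := finHeckeValue_ne_zero_of_isUnit L v μ hud₁
  have hμd₀ : finHeckeValue L v μ d₀ ≠ 0 := finHeckeValue_ne_zero_of_isUnit L v μ hdu₀
  have hμd₁ : finHeckeValue L v μ d₁ ≠ 0 := finHeckeValue_ne_zero_of_isUnit L v μ hdu₁
  have hμdet : finHeckeValue L v μ (((γH.1.val⁻¹).val : Matrix (Fin 2) (Fin 2) (LocalRing L v)).det) *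
      (finHeckeValue L v μ d₀ * finHeckeValue L v μ d₁) = 1 := by
    rw [← finHeckeValue_mul L v μ hdu₀ hdu₁]
    exact finHeckeValue_mul_eq_one_of_mul_eq_one L v μ hdet
  -- unfold `τ_v` and `D_{G∕H,v}`
  have hτ : finTau L v γH μ = finHeckeValue L v μ u *
      (finHeckeValue L v μ (-1) * finHeckeValue L v μ (u - d₀) * finHeckeValue L v μ (u - d₁) *
        finHeckeValue L v μ (((γH.1.val⁻¹).val : Matrix (Fin 2) (Fin 2) (LocalRing L v)).det))⁻¹ := by
    unfold finTau finTauArg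
    rw [← hudef, hχ, show -((u - d₀) * (u - d₁)) * ((γH.1.val⁻¹).val : Matrix (Fin 2) (Fin 2) (LocalRing L v)).det =
        (-1) * (u - d₀) * (u - d₁) * ((γH.1.val⁻¹).val : Matrix (Fin 2) (Fin 2) (LocalRing L v)).det by ring,
      finHeckeValue_mul L v μ ((hm1.mul hud₀).mul hud₁) hdetu, finHeckeValue_mul L v μ (hm1.mul hud₀) hud₁, finHeckeValue_mul L v μ hm1 hud₀]
  have hD : (finWeylRatio L v γH : ℂ) =
      ((Real.sqrt (∏ w' : PlacesOver L v, ‖(u - d₀) w'‖) : ℝ) : ℂ) * ((Real.sqrt (∏ w' : PlacesOver L v, ‖(u - d₁) w'‖) : ℝ) : ℂ) := by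
    unfold finWeylRatio
    rw [← hudef, hχ, sqrt_prod_norm_mul, Complex.ofReal_mul]
  -- assemble
  rw [hτ, hD]
  have key : (finHeckeValue L v μ (u - d₀))⁻¹ * ((Real.sqrt (∏ w' : PlacesOver L v, ‖(u - d₀) w'‖) : ℝ) : ℂ) *
      ((finHeckeValue L v μ (u - d₁))⁻¹ * ((Real.sqrt (∏ w' : PlacesOver L v, ‖(u - d₁) w'‖) : ℝ) : ℂ)) =
      (finHeckeValue L v μ d₀)⁻¹ * C₁⁻¹ * ((-1 : ℂ) ^ n₀ * (q ^ n₀)⁻¹) *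
        ((finHeckeValue L v μ d₁)⁻¹ * C₁⁻¹ * ((-1 : ℂ) ^ n₁ * (q ^ n₁)⁻¹)) := by rw [h₀, h₁]
  have hq : q ≠ 0 := by
    rw [hqdef, Nat.cast_ne_zero]
    exact Nat.card_pos.ne'  -- finite nonempty quotient
  -- `μ(det)` in terms of `μ(d₀) μ(d₁)`
  have hμdet' : finHeckeValue L v μ (((γH.1.val⁻¹).val : Matrix (Fin 2) (Fin 2) (LocalRing L v)).det) =
      (finHeckeValue L v μ d₀ * finHeckeValue L v μ d₁)⁻¹ := eq_inv_of_mul_eq_one_left hμdet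
  rw [hμdet']
  field_simp
  -- remaining polynomial identity
  have e : ((Real.sqrt (∏ w' : PlacesOver L v, ‖(u - d₀) w'‖) : ℝ) : ℂ) * ((Real.sqrt (∏ w' : PlacesOver L v, ‖(u - d₁) w'‖) : ℝ) : ℂ) *
      (finHeckeValue L v μ d₀ * finHeckeValue L v μ d₁ * C₁ ^ 2 * q ^ (n₀ + n₁)) =
      (-1 : ℂ) ^ (n₀ + n₁) * (finHeckeValue L v μ (u - d₀) * finHeckeValue L v μ (u - d₁)) := by
    have := key
    field_simp at this
    rw [pow_add, pow_add]
    linear_combination this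
  linear_combination (finHeckeValue L v μ u) * e

end Head

/-! ## §3 (ED. 2, append-only) `μ_v(u) = 1` for deep `u`; the ASSEMBLED factor `Δ‴_v` on matched pairs (road «S3-tree» T5-d, contract binder `hT5`) -/

section Assembly

variable (hunr : Algebra.IsUnramifiedIn (𝓞 L) v.asIdeal) (μ : HeckeCharacter L)
  (hμω : ∀ x : ideleGroup ↥(maximalRealSubfield L), μ (AdeleRing.ideleBaseChange ↥(maximalRealSubfield L) L x) = quadraticHeckeCharCM L x)

include hw in
/-- **`μ_v(u) = 1` for `u` deep**: there is `M₁ ≥ 1` with `μ_v(u) = 1` whenever `|u_w − 1|_w ≤ |ϖ_v|_w^{M₁}` (★ `exists_forall_localComponent_eq_one_of_valued_sub_one_le`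
read through ★ `finHeckeValue_eq_localComponent_of_nonsplit`; no guard, no unramifiedness). [cite: TateThesis1967, §2.3] [cite: Rogawski1990, §4.9 p. 55] -/
theorem exists_finHeckeValue_eq_one_of_valued_sub_one_le :
    ∃ M₁ : ℕ, 1 ≤ M₁ ∧ ∀ u : LocalRing L v, u w ≠ 0 →
      Valued.v (u w - 1) ≤
        Valued.v ((toPlace v w (HeckeCharacter.uniformizer ↥(maximalRealSubfield L) v : v.adicCompletion ↥(maximalRealSubfield L))) ^ M₁) →
      finHeckeValue L v μ u = 1 := by
  haveI : Algebra.IsQuadraticExtension ↥(maximalRealSubfield L) L := IsCMField.isQuadraticExtension L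
  haveI hv : Subsingleton (PlacesOver L v) :=
    PlacesOver.subsingleton_of_smul_eq (IsCMField.complexConj L) (IsCMField.complexConj_ne_one L) w hw
  obtain ⟨M₁, hM₁, h⟩ := exists_forall_localComponent_eq_one_of_valued_sub_one_le L v w μ
  refine ⟨M₁, hM₁, fun u hu0 hle => ?_⟩
  have hune : u ≠ 0 := fun h0 => hu0 (by rw [h0, Pi.zero_apply])
  have hu : IsUnit u := isUnit_localRing_of_ne_zero_of_subsingleton L v hv hune
  have hunit : MulEquiv.piUnits hu.unit w = Units.mk0 (u w) hu0 := Units.ext rfl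
  rw [finHeckeValue_eq_localComponent_of_nonsplit L v w hw μ hu, hunit, h (u w) hu0 hle, Units.val_one]

include hw hunr hμω in
/-- **T5-d — THE ASSEMBLED FACTOR on matched pairs (contract binder `hT5` of road «S3-tree», architect A-p16 census v3 A-50∕A-52).**  Unramified inert `v`, guard
`μ|_{𝕀_{L⁺}} = ω`: there are `M₀` and `C ≠ 0` such that for every deep type-(1) `γ_H` (frame identities and depths as in `exists_finTau_mul_finWeylRatio_eq_of_depths`)
and every `γ′ ∈ G′_v` MATCHED with `γ_H` (★ `IsLocalNormPair`):
`Δ‴_v(γ_H, γ′) = μ_v(u) · C · (−1)^{n₀+n₁} q^{−(n₀+n₁)} · κ_v(γ_H, γ′)` (★ `finExplicitDelta_of_isLocalNormPair`: `Δ‴ = τ·D·κ`).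
[cite: Rogawski1990, §4.9 p. 55; Prop. 8.1.3 p. 116] [cite: LabesseLanglands1979, §2] -/
theorem exists_finExplicitDelta_eq_of_depths (H' : Matrix (Fin 3) (Fin 3) L) :
    ∃ (M₀ : ℕ) (C : ℂ), C ≠ 0 ∧
      ∀ (γH : (cmDatum L 2 (Matrix.of fun i j : Fin 2 => if i.val + j.val + 1 = 2 then (1 : L) else 0)).Local v ×
          (cmDatum L 1 (Matrix.of fun i j : Fin 1 => if i.val + j.val + 1 = 1 then (1 : L) else 0)).Local v)
        (d₀ d₁ : LocalRing L v) (n₀ n₁ : ℕ) (γ' : (cmDatum L 3 H').Local v), M₀ ≤ n₀ → M₀ ≤ n₁ →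
        conjLocal L (IsCMField.complexConj L) v d₀ * d₀ = 1 → conjLocal L (IsCMField.complexConj L) v d₁ * d₁ = 1 →
        conjLocal L (IsCMField.complexConj L) v (finGammaTwo L v γH) * finGammaTwo L v γH = 1 →
        (finCharpolyTwo L v γH).eval (finGammaTwo L v γH) = (finGammaTwo L v γH - d₀) * (finGammaTwo L v γH - d₁) →
        ((γH.1.val⁻¹).val : Matrix (Fin 2) (Fin 2) (LocalRing L v)).det * (d₀ * d₁) = 1 →
        Valued.v (finGammaTwo L v γH w - d₀ w) =
          Valued.v ((toPlace v w (HeckeCharacter.uniformizer ↥(maximalRealSubfield L) v : v.adicCompletion ↥(maximalRealSubfield L))) ^ n₀) →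
        Valued.v (finGammaTwo L v γH w - d₁ w) =
          Valued.v ((toPlace v w (HeckeCharacter.uniformizer ↥(maximalRealSubfield L) v : v.adicCompletion ↥(maximalRealSubfield L))) ^ n₁) →
        IsLocalNormPair L H' v γH γ' →
        finExplicitDelta L v H' γH μ γ' =
          finHeckeValue L v μ (finGammaTwo L v γH) * C *
            ((-1 : ℂ) ^ (n₀ + n₁) * (((Nat.card (𝓞 ↥(maximalRealSubfield L) ⧸ v.asIdeal) : ℂ) ^ (n₀ + n₁)))⁻¹) *
            ((finKappaAt L v H' γH γ' : ℤ) : ℂ) := by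
  obtain ⟨M₀, C, hC, h⟩ := exists_finTau_mul_finWeylRatio_eq_of_depths L v w hw hunr μ hμω
  refine ⟨M₀, C, hC, fun γH d₀ d₁ n₀ n₁ γ' hn₀ hn₁ hd₀ hd₁ hu hχ hdet hv₀ hv₁ hpair => ?_⟩
  rw [finExplicitDelta_of_isLocalNormPair L v H' γH μ hpair, h γH d₀ d₁ n₀ n₁ hn₀ hn₁ hd₀ hd₁ hu hχ hdet hv₀ hv₁]

end Assembly

/-! ## §4 (ED. 2) PLACE-AGNOSTIC FACTORISATION: the rank-3 factor `τ_v·D_{G∕H,v}` of a type-(1) `γ_H` is the product of two rank-one factors -/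

section Factorisation

variable (μ : HeckeCharacter L)

/-- **`τ_v(γ_H)·D_{G∕H,v}(γ_H) = μ_v(u)·μ_v(−1)⁻¹ · Π_{i=0,1} [μ_v(d_i) · μ_v(u − d_i)⁻¹ · (Π_{w′}‖(u − d_i)_{w′}‖)^{1∕2}]`** at ANY finite place (no unramifiedness, no
guard): for `γ_H = (g, u)` with norm-one eigenvalue data `d₀, d₁` of `g` entered as the frame identities `χ_g(u) = (u − d₀)(u − d₁)`, `det g⁻¹·(d₀d₁) = 1`, and `u − d_i`
units (`G`-regularity).  Each bracket is the rank-one factor `μ⁻¹(γ₁ − γ₃)|γ₁ − γ₃|^{1∕2}` of [Rogawski1990 Lemma 4.9.3] (up to `μ_v(d_i)`), whose VALUES are ★ at unramified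
(`RankOneUnstableDeltaValueInert`), tame (`…Ramified{,Tame}`) and wild (`…RamifiedTorusUniform` + Ψ4-book) places — so T5 at a ramified place is this lemma + those files.
[cite: Rogawski1990, §4.9 p. 55; Lemma 4.9.3 p. 56] -/
theorem finTau_mul_finWeylRatio_eq_rankOne_mul_rankOne
    (γH : (cmDatum L 2 (Matrix.of fun i j : Fin 2 => if i.val + j.val + 1 = 2 then (1 : L) else 0)).Local v ×
      (cmDatum L 1 (Matrix.of fun i j : Fin 1 => if i.val + j.val + 1 = 1 then (1 : L) else 0)).Local v)
    (d₀ d₁ : LocalRing L v) (hd₀ : conjLocal L (IsCMField.complexConj L) v d₀ * d₀ = 1) (hd₁ : conjLocal L (IsCMField.complexConj L) v d₁ * d₁ = 1)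
    (hχ : (finCharpolyTwo L v γH).eval (finGammaTwo L v γH) = (finGammaTwo L v γH - d₀) * (finGammaTwo L v γH - d₁))
    (hdet : ((γH.1.val⁻¹).val : Matrix (Fin 2) (Fin 2) (LocalRing L v)).det * (d₀ * d₁) = 1)
    (hud₀ : IsUnit (finGammaTwo L v γH - d₀)) (hud₁ : IsUnit (finGammaTwo L v γH - d₁)) :
    finTau L v γH μ * (finWeylRatio L v γH : ℂ) =
      finHeckeValue L v μ (finGammaTwo L v γH) * (finHeckeValue L v μ (-1))⁻¹ *
        ((finHeckeValue L v μ d₀ * ((finHeckeValue L v μ (finGammaTwo L v γH - d₀))⁻¹ *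
            ((Real.sqrt (∏ w' : PlacesOver L v, ‖(finGammaTwo L v γH - d₀) w'‖) : ℝ) : ℂ))) *
          (finHeckeValue L v μ d₁ * ((finHeckeValue L v μ (finGammaTwo L v γH - d₁))⁻¹ *
            ((Real.sqrt (∏ w' : PlacesOver L v, ‖(finGammaTwo L v γH - d₁) w'‖) : ℝ) : ℂ)))) := by
  set u := finGammaTwo L v γH with hudef
  have hm1 : IsUnit (-1 : LocalRing L v) := isUnit_one.neg
  have hdu₀ : IsUnit d₀ := isUnit_of_conjLocal_mul_self L v hd₀
  have hdu₁ : IsUnit d₁ := isUnit_of_conjLocal_mul_self L v hd₁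
  have hdetu : IsUnit (((γH.1.val⁻¹).val : Matrix (Fin 2) (Fin 2) (LocalRing L v)).det) := IsUnit.of_mul_eq_one _ hdet
  have hμm1 : finHeckeValue L v μ (-1) ≠ 0 := finHeckeValue_ne_zero_of_isUnit L v μ hm1
  have hμud₀ : finHeckeValue L v μ (u - d₀) ≠ 0 := finHeckeValue_ne_zero_of_isUnit L v μ hud₀
  have hμud₁ : finHeckeValue L v μ (u - d₁) ≠ 0 := finHeckeValue_ne_zero_of_isUnit L v μ hud₁
  have hμd₀ : finHeckeValue L v μ d₀ ≠ 0 := finHeckeValue_ne_zero_of_isUnit L v μ hdu₀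
  have hμd₁ : finHeckeValue L v μ d₁ ≠ 0 := finHeckeValue_ne_zero_of_isUnit L v μ hdu₁
  have hμdet : finHeckeValue L v μ (((γH.1.val⁻¹).val : Matrix (Fin 2) (Fin 2) (LocalRing L v)).det) *
      (finHeckeValue L v μ d₀ * finHeckeValue L v μ d₁) = 1 := by
    rw [← finHeckeValue_mul L v μ hdu₀ hdu₁]
    exact finHeckeValue_mul_eq_one_of_mul_eq_one L v μ hdet
  have hτ : finTau L v γH μ = finHeckeValue L v μ u *
      (finHeckeValue L v μ (-1) * finHeckeValue L v μ (u - d₀) * finHeckeValue L v μ (u - d₁) *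
        finHeckeValue L v μ (((γH.1.val⁻¹).val : Matrix (Fin 2) (Fin 2) (LocalRing L v)).det))⁻¹ := by
    unfold finTau finTauArg
    rw [← hudef, hχ, show -((u - d₀) * (u - d₁)) * ((γH.1.val⁻¹).val : Matrix (Fin 2) (Fin 2) (LocalRing L v)).det =
        (-1) * (u - d₀) * (u - d₁) * ((γH.1.val⁻¹).val : Matrix (Fin 2) (Fin 2) (LocalRing L v)).det by ring,
      finHeckeValue_mul L v μ ((hm1.mul hud₀).mul hud₁) hdetu, finHeckeValue_mul L v μ (hm1.mul hud₀) hud₁, finHeckeValue_mul L v μ hm1 hud₀]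
  have hD : (finWeylRatio L v γH : ℂ) =
      ((Real.sqrt (∏ w' : PlacesOver L v, ‖(u - d₀) w'‖) : ℝ) : ℂ) * ((Real.sqrt (∏ w' : PlacesOver L v, ‖(u - d₁) w'‖) : ℝ) : ℂ) := by
    unfold finWeylRatio
    rw [← hudef, hχ, sqrt_prod_norm_mul, Complex.ofReal_mul]
  have hμdet' : finHeckeValue L v μ (((γH.1.val⁻¹).val : Matrix (Fin 2) (Fin 2) (LocalRing L v)).det) =
      (finHeckeValue L v μ d₀ * finHeckeValue L v μ d₁)⁻¹ := eq_inv_of_mul_eq_one_left hμdet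
  rw [hτ, hD, hμdet']
  field_simp

end Factorisation

end Literature.NumberTheory.Rogawski1990

end
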